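import Summits.QuantumFields.YangMills.Theorems.AllWindowsColdBoxBoxHighLineWilsonPlaquetteTaylor
import Summits.QuantumFields.YangMills.Theorems.AllWindowsColdBoxBoxHighLinePlaquetteObsL2

/-!
# T-S5.12d `plaquetteObsL2 : PlaquetteObsL2` BY NAME (unconditional) — w5 g22's ✓`plaquetteObsL2_of (h7a : WilsonPlaquetteTaylor)`
# discharged by ✓T-S5.7a `wilsonPlaquetteTaylor` (STUB-PLAN-S5-STEP2 §8, ✓`…Step2Wick`; LINE-19 S5 ⟨stmt-QuantumFields-24004⟩/⟨24335⟩)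

Width seat `ym-line-sfw-p2-w2` (g31): the one-line closure the planner asked for (ym-idea-2 g18, 2026-08-29T20:08:19Z (b)).  The Gaussian `L²` sizes of one
plaquette observable — `E₀[(c_p⁽²⁾)²] ≤ C/β²`, `E₀[(c_p^{odd})²] ≤ C/β³`, `E₀[(c_p − c_p⁽²⁾ − c_p^{odd})²] ≤ C/β⁴` (`H ≥ 1`, `β ≥ 1`, every base point) —
now hold unconditionally: the only hypothesis of ✓`plaquetteObsL2_of` was the quartic plaquette expansion T-S5.7a, a tree theorem since
✓`…WilsonPlaquetteTaylor`.

HONEST LABEL: a support brick of STEP 2 of the XL stub S5 (`stub_landauSecondOrder`) of a critic-PASSed DRAFT line; S5, U5, ⟨24004⟩ ⟨24335⟩ ⟨24336⟩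
remain OPEN; no stub is closed by name, no crux, rung or summit is proved; **the Yang–Mills mass gap is NOT proved by this file.**
-/

set_option autoImplicit false

namespace Summit.QuantumFields.YangMills.Theorems.AllWindowsColdBoxBoxHighLine

/-- **T-S5.12d `PlaquetteObsL2`, BY NAME, unconditional** (✓`plaquetteObsL2_of` + ✓`wilsonPlaquetteTaylor`). -/
theorem plaquetteObsL2 : PlaquetteObsL2 := plaquetteObsL2_of wilsonPlaquetteTaylor

end Summit.QuantumFields.YangMills.Theorems.AllWindowsColdBoxBoxHighLine
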